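import Summits.QuantumFields.YangMills.Theorems.PoincareLipschitzSphereRayProjection
import Summits.QuantumFields.YangMills.Theorems.PoincareLipschitzProjectionAveraging
import Literature.MathematicalPhysics.QuantumFieldTheory.Balaban1983to89.B4Eq19LatticeOperators
import HarnessLib

/-!
# Crux `HistoryTailL` (stmt-QuantumFields-19936), K2 organ, road R1 (LINE 25 `CompactnessTransfer`, S2♭″ brick (Γ5b)) — FILE H-5 «UNIT LATTICE MAPS FROM
# SUB-UNIT ONES»: a lattice map `a : ℤ³ → ℝ⁴` with `‖a‖ ≤ 1` (cell averages of an `S³`-valued Sobolev map) admits a UNIT lattice map `v` with `v = a∕‖a‖`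
# on the good sites `‖a‖ ≥ r`, the EXACT bound `‖δv‖² ≤ ‖δa‖²∕(‖a y‖‖a y′‖)` on good–good bonds, and `Σ_{bad bonds}‖δv‖² ≤ 36K·r⁻²·Σ_{bad bonds}‖δa‖²`
# (Hardt–Kinderlehrer–Lin averaging on the bad bonds only) — no second-order expansion, no `θ`, no `osc²` term

Cell `ym3-torus` (YM ladder rung R3 = continuum SU(2) Yang–Mills on T³ — a RUNG, NOT the Clay problem: not d = 4, not infinite volume, not a mass
gap); TWIN-WIDTH helper seat `ym-ust-19936-w7` g13 (LEAD ★w1-19936 g10 12:29:32Z SUMMON «(Γ5b)+(Γ5) → w7»; sharpened text Γ5b′ of my 12:30:40Z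
line).  Helper `--supports stmt-QuantumFields-19936`; THEOREMS ONLY (0 `def`, 0 `sorry`, default heartbeats); imports ✓H-1 `…SphereRayProjection` (ray
projection `π_p`: on the sphere, fixes the sphere, `‖π_p y − π_p z‖² ≤ 36‖y − z‖²∕‖y − p‖²`), ✓H-2 `…ProjectionAveraging` (`exists_centre_weighted_le`), lit
✓`B4Eq19LatticeOperators` (`Zd 3`, `unitVec`).

TWO EXACT FACTS replace the second-order expansion of `π_p` near the sphere: (E1) for nonzero `a, b`, `‖a∕‖a‖ − b∕‖b‖‖² ≤ ‖a − b‖²∕(‖a‖‖b‖)`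
(`RHS − LHS = (‖a‖ − ‖b‖)²∕(‖a‖‖b‖)`); (E2) the PARTIAL NORMALISATION `N_r x := (max ‖x‖ r)⁻¹ • x` (`= r⁻¹ ×` the nearest-point projection onto the ball
`B_r`) satisfies `‖N_r x − N_r y‖² ≤ r⁻²‖x − y‖²` for all `x, y`, maps `{‖x‖ ≥ r}` onto the unit sphere (`N_r x = ‖x‖⁻¹x`) and the unit ball into itself.
Then `v := π_p ∘ N_r ∘ a` with the HKL centre `p` averaged over the BAD bonds only (those with an endpoint of norm `< r`): on good sites `π_p` fixes
`N_r(a y) = a y∕‖a y‖`, good–good bonds never see `p` and are (E1)-sharp, bad bonds pay `36·‖N_r a y − p‖⁻²·‖δ(N_r a)‖²`, averaged to `36K·r⁻²·‖δa‖²`.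

WHAT IS PROVED (ns `…Theorems.PoincareLipschitzLatticeSubunitProjection`).
* §1 ★`norm_normalize_sub_normalize_sq_le` (E1); `pnorm_eq_of_le`, `norm_pnorm_eq_one`, `norm_pnorm_le_one`, ★`norm_pnorm_sub_pnorm_sq_le` (E2, four cases,
  the mixed one by the obtuse-angle inequality of the nearest point `r·ŷ`).
* §2 ★★★ `exists_unit_of_subunit` — Γ5b′: `∃ C ≥ 0, ∀ r ∈ [½, 1], ∀ a (‖a‖ ≤ 1), ∀ T, ∃ v` unit, `v = ‖a y‖⁻¹•a y` on `{‖a y‖ ≥ r}`,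
  `‖v(y+e_μ) − v y‖² ≤ ‖a(y+e_μ) − a y‖²∕(‖a y‖‖a(y+e_μ)‖)` on good–good bonds, `Σ_{T, not good–good}‖δv‖² ≤ C·(r⁻¹)²·Σ_{T, not good–good}‖δa‖²` (`C = 36K`);
  `norm_sub_le_osc_of_good` (`‖v y − a y‖ = 1 − ‖a y‖ ≤ 1 − ‖a y‖²` on good sites).
HONEST SCOPE.  One lattice brick of S2♭″ (its continuum partner (Γ5a) — Sobolev cell averages — and the knit (Γ5) are separate files); S1″∕S2♭″,
`hHalvingBand`, K1, `MeanDeviationL`, `BlockLipschitzL`, `HistoryTailL` are NOT proved here.  YM₃ on T³ is rung R3, not Clay; YM gap NOT proved; no summit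
statement is proved here.

References: R. Hardt, D. Kinderlehrer, F.-H. Lin, Comm. Math. Phys. 105 (1986) 547–570 [HardtKinderlehrerLin1986] (§2); F. Bethuel, Acta Math. 167 (1991)
153–206 (density of smooth maps, the continuum statement this lattice device sidesteps).
-/

set_option autoImplicit false

noncomputable section

open scoped BigOperators InnerProductSpace
open RealInnerProductSpace Finset

namespace Summit.QuantumFields.YangMills.Theorems.PoincareLipschitzLatticeSubunitProjection

open Literature.MathematicalPhysics.QuantumFieldTheory.Balaban1983to89
open B4Eq19LatticeOperators (Zd unitVec)
open Summit.QuantumFields.YangMills.Theorems.PoincareLipschitzSphereRayProjection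
  (norm_rayProj_eq_one rayProj_eq_self_of_norm_eq_one norm_rayProj_sub_rayProj_sq_le)
open Summit.QuantumFields.YangMills.Theorems.PoincareLipschitzProjectionAveraging (exists_centre_weighted_le)

variable {V : Type*} [NormedAddCommGroup V] [InnerProductSpace ℝ V]

/-! ## §1 (E1) the exact normalisation inequality and (E2) the partial normalisation `N_r x = (max ‖x‖ r)⁻¹ • x` -/

/-- ★ (E1) For nonzero `a, b`: `‖a∕‖a‖ − b∕‖b‖‖² ≤ ‖a − b‖²∕(‖a‖‖b‖)` — exactly, since `RHS − LHS = (‖a‖ − ‖b‖)²∕(‖a‖‖b‖)`. [folklore] -/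
theorem norm_normalize_sub_normalize_sq_le (a b : V) (ha : a ≠ 0) (hb : b ≠ 0) :
    ‖‖a‖⁻¹ • a - ‖b‖⁻¹ • b‖ ^ 2 ≤ ‖a - b‖ ^ 2 / (‖a‖ * ‖b‖) := by
  have hA : 0 < ‖a‖ := norm_pos_iff.mpr ha
  have hB : 0 < ‖b‖ := norm_pos_iff.mpr hb
  have hAB : 0 < ‖a‖ * ‖b‖ := mul_pos hA hB
  have h1 : ‖‖a‖⁻¹ • a - ‖b‖⁻¹ • b‖ ^ 2 = 2 - 2 * (‖a‖⁻¹ * ‖b‖⁻¹ * ⟪a, b⟫) := by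
    rw [norm_sub_sq_real, norm_smul, norm_smul, Real.norm_of_nonneg (inv_nonneg.mpr hA.le),
      Real.norm_of_nonneg (inv_nonneg.mpr hB.le), inv_mul_cancel₀ hA.ne', inv_mul_cancel₀ hB.ne',
      real_inner_smul_left, real_inner_smul_right]
    ring
  have h2 : ‖a - b‖ ^ 2 = ‖a‖ ^ 2 - 2 * ⟪a, b⟫ + ‖b‖ ^ 2 := norm_sub_sq_real a b
  rw [h1, h2, le_div_iff₀ hAB]
  have h3 : (2 - 2 * (‖a‖⁻¹ * ‖b‖⁻¹ * ⟪a, b⟫)) * (‖a‖ * ‖b‖) = 2 * (‖a‖ * ‖b‖) - 2 * ⟪a, b⟫ := by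
    calc (2 - 2 * (‖a‖⁻¹ * ‖b‖⁻¹ * ⟪a, b⟫)) * (‖a‖ * ‖b‖)
        = 2 * (‖a‖ * ‖b‖) - 2 * ⟪a, b⟫ * ((‖a‖⁻¹ * ‖a‖) * (‖b‖⁻¹ * ‖b‖)) := by ring
      _ = 2 * (‖a‖ * ‖b‖) - 2 * ⟪a, b⟫ := by rw [inv_mul_cancel₀ hA.ne', inv_mul_cancel₀ hB.ne']; ring
  rw [h3]
  nlinarith [sq_nonneg (‖a‖ - ‖b‖)]

/-- On `{‖x‖ ≥ r}` the partial normalisation is the plain one: `N_r x = ‖x‖⁻¹ • x`. [folklore] -/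
theorem pnorm_eq_of_le {r : ℝ} {x : V} (h : r ≤ ‖x‖) : (max ‖x‖ r)⁻¹ • x = ‖x‖⁻¹ • x := by
  rw [max_eq_left h]

/-- On `{‖x‖ ≥ r}` (`r > 0`) the partial normalisation is a unit vector. [folklore] -/
theorem norm_pnorm_eq_one {r : ℝ} (hr : 0 < r) {x : V} (h : r ≤ ‖x‖) : ‖(max ‖x‖ r)⁻¹ • x‖ = 1 := by
  have hx : 0 < ‖x‖ := hr.trans_le h
  rw [pnorm_eq_of_le h, norm_smul, Real.norm_of_nonneg (inv_nonneg.mpr hx.le), inv_mul_cancel₀ hx.ne']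

/-- The partial normalisation maps into the closed unit ball (`r > 0`). [folklore] -/
theorem norm_pnorm_le_one {r : ℝ} (hr : 0 < r) (x : V) : ‖(max ‖x‖ r)⁻¹ • x‖ ≤ 1 := by
  have hm : 0 < max ‖x‖ r := lt_max_of_lt_right hr
  rw [norm_smul, Real.norm_of_nonneg (inv_nonneg.mpr hm.le), inv_mul_le_iff₀ hm, mul_one]
  exact le_max_left _ _

/-- ★ (E2) The partial normalisation is `r⁻¹`-Lipschitz (squared form): `‖N_r x − N_r y‖² ≤ r⁻²·‖x − y‖²` for all `x, y` (`r > 0`).  Inside–inside: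
equality; outside–outside: (E1) and `‖x‖‖y‖ ≥ r²`; mixed: `‖x − r ŷ‖ ≤ ‖x − y‖` for `‖x‖ ≤ r < ‖y‖` (the obtuse angle at the nearest point `r ŷ` of the
ball). [folklore] -/
theorem norm_pnorm_sub_pnorm_sq_le {r : ℝ} (hr : 0 < r) (x y : V) :
    ‖(max ‖x‖ r)⁻¹ • x - (max ‖y‖ r)⁻¹ • y‖ ^ 2 ≤ (r⁻¹) ^ 2 * ‖x - y‖ ^ 2 := by
  -- the mixed case as a lemma: `‖x‖ ≤ r ≤ ‖y‖` ⇒ `‖r⁻¹ • x − ‖y‖⁻¹ • y‖² ≤ r⁻² ‖x − y‖²`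
  have mixed : ∀ x y : V, ‖x‖ ≤ r → r ≤ ‖y‖ →
      ‖r⁻¹ • x - ‖y‖⁻¹ • y‖ ^ 2 ≤ (r⁻¹) ^ 2 * ‖x - y‖ ^ 2 := by
    intro x y hx hy
    have hY : 0 < ‖y‖ := hr.trans_le hy
    set σ : ℝ := r * ‖y‖⁻¹ with hσ
    have hσ0 : 0 ≤ σ := by positivity
    have hσY : σ * ‖y‖ = r := by rw [hσ, mul_assoc, inv_mul_cancel₀ hY.ne', mul_one]
    have hσ1 : σ ≤ 1 := by
      rw [hσ]; rw [mul_inv_le_iff₀ hY, one_mul]; exact hy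
    -- `r⁻¹ • x − ‖y‖⁻¹ • y = r⁻¹ • (x − σ • y)`
    have hfac : r⁻¹ • x - ‖y‖⁻¹ • y = r⁻¹ • (x - σ • y) := by
      rw [smul_sub, smul_smul, hσ, ← mul_assoc, inv_mul_cancel₀ hr.ne', one_mul]
    rw [hfac, norm_smul, Real.norm_of_nonneg (inv_nonneg.mpr hr.le), mul_pow]
    refine mul_le_mul_of_nonneg_left ?_ (by positivity)
    -- `‖x − σ y‖² ≤ ‖x − y‖²`: the obtuse angle at the nearest point `σ y = r ŷ` of the ball `B_r`
    have hinner : ⟪x, y⟫ ≤ σ * ‖y‖ ^ 2 := by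
      calc ⟪x, y⟫ ≤ ‖x‖ * ‖y‖ := real_inner_le_norm x y
        _ ≤ r * ‖y‖ := mul_le_mul_of_nonneg_right hx (norm_nonneg _)
        _ = σ * ‖y‖ ^ 2 := by rw [← hσY]; ring
    have hinner' : ⟪x, y⟫ ≤ ‖y‖ ^ 2 := hinner.trans (by nlinarith [sq_nonneg ‖y‖])
    have e1 : ‖x - σ • y‖ ^ 2 = ‖x‖ ^ 2 - 2 * σ * ⟪x, y⟫ + σ ^ 2 * ‖y‖ ^ 2 := by
      rw [norm_sub_sq_real, real_inner_smul_right, norm_smul, Real.norm_of_nonneg hσ0]; ring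
    have e2 : ‖x - y‖ ^ 2 = ‖x‖ ^ 2 - 2 * ⟪x, y⟫ + ‖y‖ ^ 2 := norm_sub_sq_real x y
    rw [e1, e2]
    have h1 : 0 ≤ 1 - σ := by linarith
    have h2 : 0 ≤ ‖y‖ ^ 2 * (1 + σ) - 2 * ⟪x, y⟫ := by nlinarith
    nlinarith [mul_nonneg h1 h2]
  rcases le_total ‖x‖ r with hx | hx <;> rcases le_total ‖y‖ r with hy | hy
  · -- inside–inside: equality
    rw [max_eq_right hx, max_eq_right hy, ← smul_sub, norm_smul, Real.norm_of_nonneg (inv_nonneg.mpr hr.le), mul_pow]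
  · -- x inside, y outside
    rw [max_eq_right hx, max_eq_left hy]
    exact mixed x y hx hy
  · -- x outside, y inside (symmetric)
    rw [max_eq_left hx, max_eq_right hy, norm_sub_rev, norm_sub_rev x y]
    exact mixed y x hy hx
  · -- outside–outside: (E1) and `‖x‖‖y‖ ≥ r²`
    rw [max_eq_left hx, max_eq_left hy]
    have hX : 0 < ‖x‖ := hr.trans_le hx
    have hY : 0 < ‖y‖ := hr.trans_le hy
    have h1 := norm_normalize_sub_normalize_sq_le x y (norm_pos_iff.mp hX) (norm_pos_iff.mp hY)
    refine h1.trans ?_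
    rw [div_eq_mul_inv, mul_comm]
    refine mul_le_mul_of_nonneg_right ?_ (sq_nonneg _)
    calc (‖x‖ * ‖y‖)⁻¹ ≤ (r * r)⁻¹ := inv_anti₀ (by positivity) (by nlinarith)
      _ = (r⁻¹) ^ 2 := by rw [mul_inv, pow_two]

/-! ## §2 ★★★ Γ5b′ — unit lattice maps from sub-unit ones -/

/-- ★★★ **Γ5b′ — UNIT LATTICE MAPS FROM SUB-UNIT ONES.**  There is `C ≥ 0` (`= 36K`, `K` the averaging constant of ✓H-2) such that for every
`r ∈ [½, 1]`, every lattice map `a : ℤ³ → ℝ⁴` with `‖a y‖ ≤ 1` and every finite bond set `T` there is a UNIT lattice map `v` with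
(i) `v y = ‖a y‖⁻¹ • a y` whenever `r ≤ ‖a y‖`; (ii) on bonds with BOTH ends good, the exact bound `‖v(y+e_μ) − v y‖² ≤ ‖a(y+e_μ) − a y‖² ∕ (‖a y‖·‖a(y+e_μ)‖)`;
(iii) `Σ_{e ∈ T, not both ends good} ‖δv‖² ≤ C·(r⁻¹)²·Σ_{e ∈ T, not both ends good} ‖δa‖²`.  Construction `v := π_p ∘ N_r ∘ a`, the centre `p` averaged over the
bad bonds only. [cite: HardtKinderlehrerLin1986, §2] -/
theorem exists_unit_of_subunit : ∃ C : ℝ, 0 ≤ C ∧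
    ∀ (r : ℝ), 1 / 2 ≤ r → r ≤ 1 → ∀ (a : Zd 3 → EuclideanSpace ℝ (Fin 4)), (∀ y, ‖a y‖ ≤ 1) →
      ∀ T : Finset (Zd 3 × Fin 3),
        ∃ v : Zd 3 → EuclideanSpace ℝ (Fin 4),
          (∀ y, ‖v y‖ = 1) ∧
          (∀ y, r ≤ ‖a y‖ → v y = ‖a y‖⁻¹ • a y) ∧
          (∀ (y : Zd 3) (μ : Fin 3), r ≤ ‖a y‖ → r ≤ ‖a (y + unitVec μ)‖ →
            ‖v (y + unitVec μ) - v y‖ ^ 2 ≤ ‖a (y + unitVec μ) - a y‖ ^ 2 / (‖a y‖ * ‖a (y + unitVec μ)‖)) ∧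
          ∑ e ∈ T with ¬ (r ≤ ‖a e.1‖ ∧ r ≤ ‖a (e.1 + unitVec e.2)‖), ‖v (e.1 + unitVec e.2) - v e.1‖ ^ 2 ≤
            C * (r⁻¹) ^ 2 * ∑ e ∈ T with ¬ (r ≤ ‖a e.1‖ ∧ r ≤ ‖a (e.1 + unitVec e.2)‖), ‖a (e.1 + unitVec e.2) - a e.1‖ ^ 2 := by
  classical
  obtain ⟨K, hK0, hK⟩ := exists_centre_weighted_le.{0}
  refine ⟨36 * K, by positivity, ?_⟩
  intro r hr hr1 a ha T
  have hr0 : 0 < r := by linarith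
  -- the partial normalisation of `a`
  set Na : Zd 3 → EuclideanSpace ℝ (Fin 4) := fun y => (max ‖a y‖ r)⁻¹ • a y with hNa
  have hNa1 : ∀ y, ‖Na y‖ ≤ 1 := fun y => norm_pnorm_le_one hr0 (a y)
  have hN : (Set.range Na).Countable := Set.countable_range Na
  -- the bad bonds and the averaged centre
  set Tb : Finset (Zd 3 × Fin 3) := T.filter fun e => ¬ (r ≤ ‖a e.1‖ ∧ r ≤ ‖a (e.1 + unitVec e.2)‖) with hTb
  obtain ⟨p, hp, hpN, hsum⟩ := hK (Zd 3 × Fin 3) Tb (fun e => ‖Na (e.1 + unitVec e.2) - Na e.1‖ ^ 2) (fun e => Na e.1)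
    (Set.range Na) (fun e _ => by positivity) (fun e _ => hNa1 e.1) hN
  have hne : ∀ y, Na y ≠ p := fun y h => hpN ⟨y, h⟩
  have hp' : ‖p‖ ≤ 1 / 2 := hp.le
  -- the ray projection from `p`
  set π : EuclideanSpace ℝ (Fin 4) → EuclideanSpace ℝ (Fin 4) := fun x =>
    p + (-⟪p, ‖x - p‖⁻¹ • (x - p)⟫ + Real.sqrt (⟪p, ‖x - p‖⁻¹ • (x - p)⟫ ^ 2 + (1 - ‖p‖ ^ 2))) •
      (‖x - p‖⁻¹ • (x - p)) with hπ
  have hgood : ∀ y, r ≤ ‖a y‖ → π (Na y) = ‖a y‖⁻¹ • a y := by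
    intro y hy
    have h1 : Na y = ‖a y‖⁻¹ • a y := pnorm_eq_of_le hy
    have h2 : ‖Na y‖ = 1 := norm_pnorm_eq_one hr0 hy
    rw [← h1]
    exact rayProj_eq_self_of_norm_eq_one p (Na y) hp' h2
  refine ⟨fun y => π (Na y), fun y => norm_rayProj_eq_one p (Na y) hp' (hne y), hgood, ?_, ?_⟩
  · -- (ii) good–good bonds: plain normalisation at both ends, (E1)
    intro y μ hy hy'
    have hay : a y ≠ 0 := norm_pos_iff.mp (hr0.trans_le hy)
    have hay' : a (y + unitVec μ) ≠ 0 := norm_pos_iff.mp (hr0.trans_le hy')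
    show ‖π (Na (y + unitVec μ)) - π (Na y)‖ ^ 2 ≤ _
    rw [hgood y hy, hgood _ hy', norm_sub_rev (‖a (y + unitVec μ)‖⁻¹ • a (y + unitVec μ))]
    have := norm_normalize_sub_normalize_sq_le (a y) (a (y + unitVec μ)) hay hay'
    rwa [norm_sub_rev (a y)] at this
  · -- (iii) bad bonds: HKL bound, the average, the `r⁻¹`-Lipschitz bound of `N_r`
    have hbond : ∀ e ∈ Tb, ‖π (Na (e.1 + unitVec e.2)) - π (Na e.1)‖ ^ 2 ≤
        36 * (‖Na (e.1 + unitVec e.2) - Na e.1‖ ^ 2 * (‖Na e.1 - p‖ ^ 2)⁻¹) := by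
      intro e _
      have h := norm_rayProj_sub_rayProj_sq_le p (Na e.1) (Na (e.1 + unitVec e.2)) hp' (hne e.1) (hne _)
      rw [norm_sub_rev (Na e.1) (Na (e.1 + unitVec e.2)), div_eq_mul_inv, mul_assoc] at h
      calc ‖π (Na (e.1 + unitVec e.2)) - π (Na e.1)‖ ^ 2 = ‖π (Na e.1) - π (Na (e.1 + unitVec e.2))‖ ^ 2 := by
            rw [norm_sub_rev]
        _ ≤ _ := h
    have hLip : ∀ e ∈ Tb, ‖Na (e.1 + unitVec e.2) - Na e.1‖ ^ 2 ≤ (r⁻¹) ^ 2 * ‖a (e.1 + unitVec e.2) - a e.1‖ ^ 2 :=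
      fun e _ => norm_pnorm_sub_pnorm_sq_le hr0 (a (e.1 + unitVec e.2)) (a e.1)
    show ∑ e ∈ Tb, ‖π (Na (e.1 + unitVec e.2)) - π (Na e.1)‖ ^ 2 ≤ 36 * K * (r⁻¹) ^ 2 * ∑ e ∈ Tb, ‖a (e.1 + unitVec e.2) - a e.1‖ ^ 2
    calc ∑ e ∈ Tb, ‖π (Na (e.1 + unitVec e.2)) - π (Na e.1)‖ ^ 2
        ≤ ∑ e ∈ Tb, 36 * (‖Na (e.1 + unitVec e.2) - Na e.1‖ ^ 2 * (‖Na e.1 - p‖ ^ 2)⁻¹) := Finset.sum_le_sum hbond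
      _ = 36 * ∑ e ∈ Tb, ‖Na (e.1 + unitVec e.2) - Na e.1‖ ^ 2 * (‖Na e.1 - p‖ ^ 2)⁻¹ := by rw [Finset.mul_sum]
      _ ≤ 36 * (K * ∑ e ∈ Tb, ‖Na (e.1 + unitVec e.2) - Na e.1‖ ^ 2) := mul_le_mul_of_nonneg_left hsum (by norm_num)
      _ ≤ 36 * (K * ∑ e ∈ Tb, (r⁻¹) ^ 2 * ‖a (e.1 + unitVec e.2) - a e.1‖ ^ 2) :=
          mul_le_mul_of_nonneg_left (mul_le_mul_of_nonneg_left (Finset.sum_le_sum hLip) hK0) (by norm_num)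
      _ = 36 * K * (r⁻¹) ^ 2 * ∑ e ∈ Tb, ‖a (e.1 + unitVec e.2) - a e.1‖ ^ 2 := by rw [← Finset.mul_sum]; ring

/-- Corollary (the distance-to-`a` row the consumer uses on good sites): `‖‖a y‖⁻¹ • a y − a y‖ = 1 − ‖a y‖ ≤ 1 − ‖a y‖²` for `0 < ‖a y‖ ≤ 1`. [folklore] -/
theorem norm_normalize_sub_self_le (x : V) (hx : x ≠ 0) (hx1 : ‖x‖ ≤ 1) :
    ‖‖x‖⁻¹ • x - x‖ = 1 - ‖x‖ ∧ 1 - ‖x‖ ≤ 1 - ‖x‖ ^ 2 := by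
  have hX : 0 < ‖x‖ := norm_pos_iff.mpr hx
  constructor
  · have : ‖x‖⁻¹ • x - x = (‖x‖⁻¹ - 1) • x := by rw [sub_smul, one_smul]
    rw [this, norm_smul, Real.norm_of_nonneg (by rw [sub_nonneg]; exact (one_le_inv₀ hX).mpr hx1), sub_mul,
      inv_mul_cancel₀ hX.ne', one_mul]
  · nlinarith

end Summit.QuantumFields.YangMills.Theorems.PoincareLipschitzLatticeSubunitProjection

end
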